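import Summits.PneNP.GCT.Max.KYAllMArithmetic
import Summits.PneNP.GCT.Max.KYPaddedPermanentSide
import Summits.PneNP.GCT.Max.DetKYLeadingTerms
import HarnessLib
import HarnessLib.Audit

/-!
# `GCT/Max`: the ALL-`m` Koszul–Young flattening ceiling — for every `m` and every `n ≥ 2m+2`, plain Koszul–Young flattenings
# do not separate the padded `m × m` permanent `X₀₀^{n-m}·per_m` from `det_n` (N-F-1 / C-F-3′ for all `m`, PROVED)

Cell `pub-gct-max` (HOME `run/shared/lean/pub/pub-gct-max/`), track F, banked input P4 (director-valiant g7 ROW-SUPPLY W1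
2026-08-27, LEAD gen 31 desk; D-0044 banked input — no paper, no writer): the all-`m` generalisation of
`kyCannotSeparatePaddedPerThreeFromFive_holds` (module `KYCannotSeparatePaddedPerThreeFromFive`: `m = 3`, every `n ≥ 5`), written and
kernel-checked by theory-2 (gen 25) from the two new layers `Max/KYAllMArithmetic` (Lemma A for every `m`, the per-`k` criterion,
the stage-2 cell bound `KYStageTwoCellBoundAllM`) and `Max/KYPaddedPermanentSide` (the padded-`per_m` side `PaddedPerKYUpperBounds`)
and lit-2's leading-term lower bound `detKYLeadingTermBound_holds` (`Max/DetKYLeadingTerms(Family)`: `max(LT, LT^dual) ≤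
rank KY_{p,k}(det_n)`, transpose duality on the determinant side only). Mathematics: memo `CF3-THEOREM.md` §1–§4 (v1.1
`9ea98dd57dfc3673`, referee-read PASS 2026-08-23T04:18Z; NOT IN PRINT — lit-2 D61 / lit-1 D70). Everything PROVED (0 sorry, standard
axioms); no conjecture of the cell is used or asserted — in particular NOT the typed transport law `KYPaddingTransportLaw` and NOT the
9-letter table nodes of `Max/KYPaddingTransport(Cone)` / `Max/KYOuterRows` / `Max/KYOuterColumns`, which concern the complementary
window `m+1 ≤ n < 2m+2` (at `m = 3`: `n = 4 … 7`, covered in the tree by exact-rank certificates / the 684 stage-3 cells) and are not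
needed at or above the threshold. HONEST FRAMING: a LOCATED NEGATIVE about ONE family of equations (Koszul–Young flattenings
`Λ^p ⊗ S^k`, [LandsbergGCT2017] §8.2.1) for padded permanents of every size — not a statement about other Young flattenings, border
apolarity or multiplicity obstructions, not a `per` versus `det` lower bound; occurrence obstructions are ruled out in print (BIP'16)
— multiplicity obstructions are the open door; nothing here is a claim on VP vs VNP or P vs NP.

**What is proved (`KYCannotSeparatePaddedPerAllM`, `kyCannotSeparatePaddedPerAllM_holds`).** For every `m`, every `n ≥ 2m+2` and
every `(p, k)`: `rank KY_{p,k}(X₀₀^{n-m}·per_m) ≤ rank KY_{p,k}(det_n)` in `S^n(ℂ^{n²})`. Chain per cell (`N = n²`; the trivial ranges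
`k ≥ n`, `p ≥ N` give `0` on the left): at a primal cell `k ≤ (n-1)/2` the padded side is `≤ S(m,k)·C(N,p)` (low-order no-syzygy
bound), `S(m,k)·C(N,p) ≤ LT(n, N-1-p, k)` (`KYStageTwoCellBoundAllM`: Lemma A + smoothing, the `p`-dependence cancels) and
`LT ≤ rank KY_{p,k}(det_n)`; at a dual cell `k > (n-1)/2` the padded side is `≤ S(m,n-1-k)·C(N,p+1) = S(m,n-1-k)·C(N,N-1-p)` (HIGH-order
bound, refined Leibniz — no duality needed on the permanent side), then `KYStageTwoCellBoundAllM` at the cell `(N-1-p, n-1-k)` and the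
dual leading-term count `LT(n, p, n-1-k) ≤ rank KY_{p,k}(det_n)`.

**Threshold.** `n₀(m) = 2m+2` is explicit and linear; it is SHARP FOR THE METHOD (`KYPerkCriterionSharpAllM`: the `k = 1` criterion
fails at `n = 2m+1` for every `m ≥ 1`), not claimed sharp for the ranks: at `m = 3` it gives `n ≥ 8`, while the tree's
`KYCannotSeparatePaddedPerThreeFromFive` reaches `n ≥ 5` by finite cell tables and `n = 4` rests on certificates (node
`KYCannotSeparatePaddedPerThreeAtFour`). The degenerate sizes `m = 0, 1` are included (there the statement is trivial but true).
Sanity `example` below: the `m = 3`, `n ≥ 8` slice of the m=3 node is an instance.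

## References (statements as printed: `HOME/typed/AS-PRINTED-2.md` §F; `HOME/typed/CHAIN-2.md` §4)
* [LandsbergGCT2017] §8.2.1 eq. (8.2.1), Prop. 8.2.1.1; §2.4.  * [EfremenkoLandsbergSchenckWeyman2018] §1.1, Rem. 1.3–1.4.
* [Farnsworth2016] Thm. 1.6 / 1.8.  * [CoxLittleOShea2007] Ch. 9 §3.
-/

noncomputable section

namespace Summit.PneNP.GCT

open Literature.Computability.AlgebraicComplexity Literature.Barriers.ValiantsHypothesis

namespace KYAllMAssembly

open Finset

/-- `KYAllM.chooseSqSum m k` is the `Finset.range` sum used by `Max/KYPaddedPermanentSide` (definitional). [folklore] -/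
lemma chooseSqSum_eq (m k : ℕ) : KYAllM.chooseSqSum m k = ∑ i ∈ range (k + 1), (m.choose i) ^ 2 := rfl

/-- **N-F-1 for every `m`, every `n ≥ 2m+2` and every cell `(p, k)`** — the assembly (case analysis primal / dual cell with the three
inputs `paddedPerKYUpperBounds_holds`, `kyStageTwoCellBoundAllM_holds`, `detKYLeadingTermBound_holds`). [folklore] -/
theorem kyRank_paddedPerPoly_le_detPoly (m n : ℕ) [NeZero n] (hn : 2 * m + 2 ≤ n) (p k : ℕ) :
    kyRank ℂ p k (paddedPerPoly ℂ m n) ≤ kyRank ℂ p k (detPoly (Fin n) ℂ) := by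
  have hmn : m ≤ n := by omega
  obtain ⟨hlow, hhigh, hz⟩ := paddedPerKYUpperBounds_holds m n p k hmn
  rcases Nat.lt_or_ge k n with hk | hk
  swap
  · rw [hz hk]; exact Nat.zero_le _
  rcases Nat.lt_or_ge p (n * n) with hp | hp
  swap
  · -- `p ≥ n²`: the second component of the low-order bound vanishes (`C(n², p+1) = 0`)
    have h0 : (∑ i ∈ range (k + 1 + 1), (m.choose i) ^ 2) * (n * n).choose (p + 1) = 0 := by
      rw [Nat.choose_eq_zero_of_lt (by omega : n * n < p + 1), Nat.mul_zero]
    have h := hlow.trans (min_le_right _ _)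
    rw [h0] at h
    exact h.trans (Nat.zero_le _)
  have hpN : p + 1 ≤ n * n := hp
  have hkn : k + 1 ≤ n := hk
  -- determinant side: both leading-term counts are below `rank KY_{p,k}(det_n)`
  have hdetmax := detKYLeadingTermBound_holds n p k hpN hkn
  have hdet1 : DetKYLeadingTerms.ltCount n (n * n - 1 - p) k ≤ kyRank ℂ p k (detPoly (Fin n) ℂ) :=
    (le_max_left _ _).trans hdetmax
  have hdet2 : DetKYLeadingTerms.ltCount n p (n - 1 - k) ≤ kyRank ℂ p k (detPoly (Fin n) ℂ) :=
    (le_max_right _ _).trans hdetmax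
  by_cases hks : k ≤ (n - 1) / 2
  · -- primal cell: low-order bound, stage-2 cell bound at `(p, k)`, `LT ≤ rank`
    have h1 : kyRank ℂ p k (paddedPerPoly ℂ m n) ≤ KYAllM.chooseSqSum m k * (n * n).choose p := by
      rw [chooseSqSum_eq]; exact hlow.trans (min_le_left _ _)
    exact h1.trans ((kyStageTwoCellBoundAllM_holds m n p k hn hks hpN).trans hdet1)
  · -- dual cell: high-order bound, stage-2 cell bound at `(n²-1-p, n-1-k)`, `LT^dual ≤ rank`
    have h1 : kyRank ℂ p k (paddedPerPoly ℂ m n) ≤ KYAllM.chooseSqSum m (n - 1 - k) * (n * n).choose (n * n - 1 - p) := by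
      have h := hhigh.trans (min_le_right _ _)
      rw [show n - (k + 1) = n - 1 - k by omega, ← chooseSqSum_eq,
        show n * n - 1 - p = n * n - (p + 1) by omega, Nat.choose_symm hpN] at *
      exact h
    have h2 := kyStageTwoCellBoundAllM_holds m n (n * n - 1 - p) (n - 1 - k) hn (by omega) (by omega)
    rw [show n * n - 1 - (n * n - 1 - p) = p by omega] at h2
    exact h1.trans (h2.trans hdet2)

end KYAllMAssembly

/-! ## The node -/

/-- **N-F-1 for every `m` (the all-`m` Koszul–Young flattening ceiling):** for every `m`, every `n ≥ 2m+2` and every `(p, k)`,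
`rank KY_{p,k}(X₀₀^{n-m}·per_m) ≤ rank KY_{p,k}(det_n)` in `S^n(ℂ^{n²})` — no plain Koszul–Young flattening `Λ^p ⊗ S^k` has larger
rank on the padded `m × m` permanent than on `det_n`, so none of them certifies `X₀₀^{n-m}·per_m ∉ \overline{GL_{n²}·det_n}` once
`n ≥ 2m+2` (explicit, linear threshold; sharp for the method, `KYPerkCriterionSharpAllM`). The containment itself is believed FALSE for
`n` polynomial in `m` (Valiant's hypothesis: `dc(per_m)` superpolynomial), so this says the Koszul–Young family is BLIND there, not
that the containment holds. A statement of the cell (C-F-3′ / N-F-1 for all `m`, theory-2 CF3-THEOREM §1–§4; not in print), PROVED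
below as `kyCannotSeparatePaddedPerAllM_holds`; at `m = 3` compare `KYCannotSeparatePaddedPerThreeFromFive` (`n ≥ 5`). [folklore] -/
def KYCannotSeparatePaddedPerAllM : Prop :=
  ∀ (m n : ℕ) [NeZero n], 2 * m + 2 ≤ n → ∀ p k : ℕ,
    kyRank ℂ p k (paddedPerPoly ℂ m n) ≤ kyRank ℂ p k (detPoly (Fin n) ℂ)

/-- **N-F-1 holds for every `m` and every `n ≥ 2m+2`.** [folklore] -/
theorem kyCannotSeparatePaddedPerAllM_holds : KYCannotSeparatePaddedPerAllM :=
  fun m n _ hn p k => KYAllMAssembly.kyRank_paddedPerPoly_le_detPoly m n hn p k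

/- Sanity: the `m = 3`, `n ≥ 8` slice (the stage-2 range of `KYCannotSeparatePaddedPerThreeFromFive`) is an instance. -/
example (n : ℕ) [NeZero n] (hn : 8 ≤ n) (p k : ℕ) :
    kyRank ℂ p k (paddedPerPoly ℂ 3 n) ≤ kyRank ℂ p k (detPoly (Fin n) ℂ) :=
  kyCannotSeparatePaddedPerAllM_holds 3 n (by omega) p k

end Summit.PneNP.GCT
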